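import Summits.FinalStateConjecture.FinalStateConjecture.Theorems.PhotonSphereChannelsCauchyWave
import Summits.FinalStateConjecture.FinalStateConjecture.Theorems.PhotonSphereChannelsChannelsResolveTameDevelopmentsRCutoffCalculus
import Summits.FinalStateConjecture.FinalStateConjecture.Theorems.PhotonSphereChannelsChannelsResolveTameDevelopmentsREnergyTails
import Summits.FinalStateConjecture.FinalStateConjecture.Theorems.PhotonSphereChannelsChannelsResolveTameDevelopmentsRExhaustionStability

/-!
# Route PhotonSphereChannels — density: outgoing energy exhaustion for compactly supported data implies
# exhaustion for all finite-energy Regge–Wheeler solutions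

Proves the registered sub-goal **`stub_exhaustionDensity`** (`CompactDataExhaustion →
OutgoingEnergyExhaustion`) of stub `stub_outgoingEnergyExhaustion` (H4) of line
`isolated-kerr-connected-hull` (crux stmt-FinalStateConjecture-14075), over the Literature vocabulary
`ReggeWheeler.{energyDensity, IsSolution, IsRWSolution, channelEnergy, totalEnergy, CauchyDataSupportedOn,
linePotential, IsTortoiseRadius}`.

* `RW.exists_compactData_approx` — **energy cutoff**: for `V ∈ C¹` bounded and `≥ 0`, a global `C²`
  solution `ψ` of finite energy and `ε > 0`, there is a global `C²` solution `φ` with compactly supported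
  Cauchy data and finite energy such that `ψ − φ` (a solution) has total energy `≤ ε` at `t = 0`: data
  `(χ_R f, χ_R g)` (`f = ψ(0,·) ∈ C²`, `g = ψ_t(0,·) ∈ C¹`, `χ_R` from `RW.exists_scaledBump`) solved by
  `CauchyWave.exists_solution`; the error energy is `≤ 2 ∫_{|x|>R} e[ψ](0,·) + 2 (K/R)² ∫_{|x|≤2R} f²`
  (`RW.lintegral_cutoff_le`), and the second term is `O(1/R) + O(tail)` by `RW.data_sq_bound`;
* `stub_exhaustionDensity` — the registered text: `RW.exhaustion_of_energy_approx` (stability) fed with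
  the cutoff approximants, to which the hypothesis (exhaustion for compactly supported data) applies.

No new definitions; standard material. [folklore]
-/

namespace Summit.FinalStateConjecture.FinalStateConjecture.Theorems

-- every `Summit.FinalStateConjecture.FinalStateConjecture.…` name repeats the summit = sub-problem
-- segment (D-0017 layout), as in every landed `…Theorems` file of this route
set_option linter.dupNamespace false

open MeasureTheory Set Filter Topology Metric
open scoped ENNReal
open Literature.Geometry.Lorentzian Literature.Geometry.Lorentzian.ReggeWheeler

noncomputable section

namespace RW

variable {V : ℝ → ℝ} {ψ : ℝ → ℝ → ℝ}

/-- The energy density of a `C²` function at a fixed time is continuous in `x` (private copy of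
`RW.continuous_energyDensity_slice` of `…RTotalEnergyConservation`, whose build this file does not wait
for). -/
private theorem continuous_energyDensity_slice₃ (hV : Differentiable ℝ V)
    (hψ : ContDiff ℝ 2 (Function.uncurry ψ)) (t : ℝ) :
    Continuous (fun x ↦ energyDensity V ψ t x) := by
  have he : ∀ z : ℝ × ℝ, (fun z : ℝ × ℝ ↦ energyDensity V ψ z.1 z.2) z
      = (fderiv ℝ (Function.uncurry ψ) z (1, 0)) ^ 2 + (fderiv ℝ (Function.uncurry ψ) z (0, 1)) ^ 2
        + V z.2 * Function.uncurry ψ z ^ 2 := by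
    rintro ⟨t', x⟩
    simp only [Function.uncurry_apply_pair]
    unfold energyDensity
    rw [WaveEnergy.deriv_slice_fst_eq hψ, WaveEnergy.deriv_slice_snd_eq hψ]
  exact (WaveEnergy.continuous_energyDensity hψ hV he).comp (Continuous.prodMk_right t)

/-- **Energy cutoff — compactly supported data are dense in energy among solutions.** Let `V ∈ C¹(ℝ)`
be bounded and nonnegative, `ψ` a global `C²` solution of `ψ_tt − ψ_xx + Vψ = 0` with finite total
energy at `t = 0`, and `ε > 0`.  Then there is a global `C²` solution `φ` with compactly supported
Cauchy data and finite energy such that `ψ − φ` (again a solution) has total energy `≤ ε` at `t = 0`.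
[folklore] -/
theorem exists_compactData_approx {CV : ℝ} (hV1 : ContDiff ℝ 1 V) (hVb : ∀ x, |V x| ≤ CV)
    (hV0 : ∀ x, 0 ≤ V x) (hψ : IsSolution V ψ) (hE : totalEnergy V ψ 0 < ⊤) {ε : ℝ} (hε : 0 < ε) :
    ∃ φ : ℝ → ℝ → ℝ, IsSolution V φ ∧ (∃ a b : ℝ, CauchyDataSupportedOn φ (Icc a b)) ∧
      totalEnergy V φ 0 < ⊤ ∧ IsSolution V (fun t x ↦ ψ t x - φ t x) ∧
      totalEnergy V (fun t x ↦ ψ t x - φ t x) 0 ≤ ENNReal.ofReal ε := by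
  have hVd : Differentiable ℝ V := hV1.differentiable (by simp)
  /- the data `f = ψ(0, ·) ∈ C²`, `g = ψ_t(0, ·) ∈ C¹` -/
  have hf2 : ContDiff ℝ 2 (ψ 0) := hψ.1.comp (contDiff_const.prodMk contDiff_id)
  have hg1 : ContDiff ℝ 1 (fun x ↦ deriv (fun τ ↦ ψ τ x) 0) := by
    have h1 : (fun x ↦ deriv (fun τ ↦ ψ τ x) 0) = fun x ↦ fderiv ℝ (Function.uncurry ψ) (0, x) (1, 0) :=
      funext fun x ↦ WaveEnergy.deriv_slice_fst_eq hψ.1 0 x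
    rw [h1]
    exact ((hψ.1.fderiv_right (m := 1) (by norm_num)).comp
      (contDiff_const.prodMk contDiff_id)).clm_apply contDiff_const
  have he0 : ∀ x, energyDensity V ψ 0 x
      = deriv (fun τ ↦ ψ τ x) 0 ^ 2 + deriv (ψ 0) x ^ 2 + V x * ψ 0 x ^ 2 := fun x ↦ rfl
  have he0nn : ∀ x, 0 ≤ energyDensity V ψ 0 x := fun x ↦ energyDensity_nonneg ψ 0 (hV0 x)
  have hcont_e : Continuous (fun x ↦ energyDensity V ψ 0 x) :=
    continuous_energyDensity_slice₃ hVd hψ.1 0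
  have hEfin : ∫⁻ x, ENNReal.ofReal (energyDensity V ψ 0 x) < ⊤ := hE
  /- the bump constant `K`, the growth bound `f² ≤ C₁ + 4 R τ₀`, the tail scale `R₁`, the scale `R` -/
  obtain ⟨K, hK0, hbump⟩ := exists_scaledBump
  obtain ⟨C₁, τ₀, hC₁, hτ₀, hτ₀η, hfb⟩ := data_sq_bound (hf2.of_le (by norm_num)) hcont_e he0nn
    (fun x ↦ by rw [he0]; nlinarith [sq_nonneg (deriv (fun τ ↦ ψ τ x) 0),
      mul_nonneg (hV0 x) (sq_nonneg (ψ 0 x))]) hEfin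
    (by positivity : 0 < ε / (128 * (K ^ 2 + 1)))
  obtain ⟨R₁, hR₁, hR₁tail⟩ := exists_lintegral_abs_gt_le hEfin
    (ENNReal.ofReal_pos.2 (by positivity : 0 < ε / 4))
  have hKC : 0 ≤ 32 * K ^ 2 * C₁ / ε := by positivity
  obtain ⟨R, hRpos, hRR₁, hR32⟩ : ∃ R : ℝ, 0 < R ∧ R₁ ≤ R ∧ 32 * K ^ 2 * C₁ / ε ≤ R :=
    ⟨R₁ + 1 + 32 * K ^ 2 * C₁ / ε, by linarith, by linarith, by linarith⟩
  obtain ⟨χ, c, hχc, hχd, hχ01, hχ1, hχ0, hc0, hc2⟩ := hbump R hRpos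
  /- the approximating solution `φ`: data `(χ f, χ g)` -/
  have hA : ContDiff ℝ 2 (fun x ↦ χ x * ψ 0 x) := hχc.mul hf2
  have hB : ContDiff ℝ 1 (fun x ↦ χ x * deriv (fun τ ↦ ψ τ x) 0) := (hχc.of_le (by norm_num)).mul hg1
  have hout : ∀ x, x ∉ Icc (-(2 * R)) (2 * R) → 2 * R ≤ |x| := fun x hx ↦ by
    by_contra hcon
    exact hx (abs_le.1 (le_of_not_ge hcon))
  have hA0 : ∀ x, x ∉ Icc (-(2 * R)) (2 * R) → χ x * ψ 0 x = 0 := fun x hx ↦ by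
    rw [hχ0 x (hout x hx), zero_mul]
  have hB0 : ∀ x, x ∉ Icc (-(2 * R)) (2 * R) → χ x * deriv (fun τ ↦ ψ τ x) 0 = 0 := fun x hx ↦ by
    rw [hχ0 x (hout x hx), zero_mul]
  obtain ⟨φ, hφ2, hφsol, hφ0, hφ1, -⟩ := CauchyWave.exists_solution hV1 hVb hA hA0 hB hB0
  have hφ : IsSolution V φ := ⟨hφ2, fun z ↦ hφsol z.1 z.2⟩
  have hsupp : CauchyDataSupportedOn φ (Icc (-(2 * R)) (2 * R)) := fun x hx ↦
    ⟨by rw [hφ0]; exact hA0 x hx, by rw [hφ1]; exact hB0 x hx⟩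
  have hsuppIoo : CauchyDataSupportedOn φ (Ioo (-(2 * R) - 1) (2 * R + 1)) := fun x hx ↦
    hsupp x fun h ↦ hx ⟨by linarith [h.1], by linarith [h.2]⟩
  have hφE : totalEnergy V φ 0 < ⊤ :=
    totalEnergy_lt_top hVd hV0 hφ (a := -(2 * R) - 1) (b := 2 * R + 1) (by linarith) hsuppIoo 0
  refine ⟨φ, hφ, ⟨-(2 * R), 2 * R, hsupp⟩, hφE, IsSolution.sub hψ hφ, ?_⟩
  /- the energy density of the error `w = ψ − φ` at `t = 0` -/
  have hwt : ∀ x, deriv (fun τ ↦ ψ τ x - φ τ x) 0 = (1 - χ x) * deriv (fun τ ↦ ψ τ x) 0 := by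
    intro x
    have h1 : HasDerivAt (fun τ ↦ ψ τ x) (deriv (fun τ ↦ ψ τ x) 0) 0 := by
      have h := WaveEnergy.hasDerivAt_slice_fst (WaveEnergy.differentiable_of_contDiff_two hψ.1) 0 x
      rw [← WaveEnergy.deriv_slice_fst_eq hψ.1 0 x] at h
      exact h
    have h2 : HasDerivAt (fun τ ↦ φ τ x) (χ x * deriv (fun τ ↦ ψ τ x) 0) 0 := by
      have h := WaveEnergy.hasDerivAt_slice_fst (WaveEnergy.differentiable_of_contDiff_two hφ2) 0 x
      rw [← WaveEnergy.deriv_slice_fst_eq hφ2 0 x, hφ1 x] at h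
      exact h
    have h3 : HasDerivAt (fun τ ↦ ψ τ x - φ τ x)
        (deriv (fun τ ↦ ψ τ x) 0 - χ x * deriv (fun τ ↦ ψ τ x) 0) 0 := h1.sub h2
    rw [h3.deriv]
    ring
  have hw0 : (fun y ↦ ψ 0 y - φ 0 y) = fun y ↦ ψ 0 y - χ y * ψ 0 y := by
    funext y
    rw [hφ0 y]
  have hwx : ∀ x, deriv (fun y ↦ ψ 0 y - φ 0 y) x = (1 - χ x) * deriv (ψ 0) x - c x * ψ 0 x := by
    intro x
    have h1 : HasDerivAt (ψ 0) (deriv (ψ 0) x) x := (hf2.differentiable (by simp) x).hasDerivAt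
    have h2 : HasDerivAt (fun y ↦ χ y * ψ 0 y) (c x * ψ 0 x + χ x * deriv (ψ 0) x) x :=
      (hχd x).mul h1
    have h3 : HasDerivAt (fun y ↦ ψ 0 y - χ y * ψ 0 y)
        (deriv (ψ 0) x - (c x * ψ 0 x + χ x * deriv (ψ 0) x)) x := h1.sub h2
    rw [hw0, h3.deriv]
    ring
  have hew : ∀ x, energyDensity V (fun t x ↦ ψ t x - φ t x) 0 x
      = ((1 - χ x) * deriv (fun τ ↦ ψ τ x) 0) ^ 2
        + ((1 - χ x) * deriv (ψ 0) x - c x * ψ 0 x) ^ 2 + V x * ((1 - χ x) * ψ 0 x) ^ 2 := by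
    intro x
    unfold energyDensity
    beta_reduce
    rw [hwt, hwx, hφ0 x]
    ring
  /- integrate and conclude -/
  have hD : 0 ≤ C₁ + 4 * R * τ₀ := by positivity
  have hint := lintegral_cutoff_le (g := fun x ↦ deriv (fun τ ↦ ψ τ x) 0) (f' := deriv (ψ 0))
    (f := ψ 0) (v := V) hD he0 hV0 hcont_e.measurable hχ01 hχ1 hc0 hc2 (fun x hx ↦ hfb R x hx)
  have harith : 2 * (K / R) ^ 2 * ((C₁ + 4 * R * τ₀) * (2 * (2 * R))) ≤ ε / 2 := by
    have e1 : 2 * (K / R) ^ 2 * ((C₁ + 4 * R * τ₀) * (2 * (2 * R)))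
        = 8 * K ^ 2 * C₁ / R + 32 * K ^ 2 * τ₀ := by
      field_simp
      ring
    rw [e1]
    have h1 : 8 * K ^ 2 * C₁ / R ≤ ε / 4 := by
      rw [div_le_iff₀ hRpos]
      have h := mul_le_mul_of_nonneg_left hR32 hε.le
      have e2 : ε * (32 * K ^ 2 * C₁ / ε) = 32 * K ^ 2 * C₁ := by field_simp
      nlinarith
    have h2 : 32 * K ^ 2 * τ₀ ≤ ε / 4 := by
      have h3 : 32 * K ^ 2 * τ₀ ≤ 32 * K ^ 2 * (ε / (128 * (K ^ 2 + 1))) :=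
        mul_le_mul_of_nonneg_left hτ₀η (by positivity)
      have h4 : 32 * K ^ 2 * (ε / (128 * (K ^ 2 + 1))) = (ε / 4) * (K ^ 2 / (K ^ 2 + 1)) := by
        field_simp
        ring
      have h5 : K ^ 2 / (K ^ 2 + 1) ≤ 1 := (div_le_one (by positivity)).2 (by linarith)
      nlinarith
    linarith
  calc totalEnergy V (fun t x ↦ ψ t x - φ t x) 0
      = ∫⁻ x, ENNReal.ofReal (((1 - χ x) * deriv (fun τ ↦ ψ τ x) 0) ^ 2
        + ((1 - χ x) * deriv (ψ 0) x - c x * ψ 0 x) ^ 2 + V x * ((1 - χ x) * ψ 0 x) ^ 2) := by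
        unfold totalEnergy
        exact lintegral_congr fun x ↦ by rw [hew]
    _ ≤ 2 * (∫⁻ x in {x | R < |x|}, ENNReal.ofReal (energyDensity V ψ 0 x))
        + ENNReal.ofReal (2 * (K / R) ^ 2 * ((C₁ + 4 * R * τ₀) * (2 * (2 * R)))) := hint
    _ ≤ 2 * ENNReal.ofReal (ε / 4) + ENNReal.ofReal (ε / 2) := by
        gcongr
        · exact hR₁tail R hRR₁
    _ = ENNReal.ofReal ε := by
        rw [← ENNReal.ofReal_ofNat 2, ← ENNReal.ofReal_mul (by norm_num),
          ← ENNReal.ofReal_add (by positivity) (by positivity)]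
        congr 1
        ring

end RW

/-- **Registered sub-goal `stub_exhaustionDensity` of stub `stub_outgoingEnergyExhaustion` (H4)** (crux
stmt-FinalStateConjecture-14075, line `isolated-kerr-connected-hull`): if the forward channel energy of
`ψ(T + ·)` through the bare cone about `xc` exhausts the total energy as `T → +∞` for every finite-energy
Regge–Wheeler solution with compactly supported Cauchy data, then it does so for every finite-energy
Regge–Wheeler solution (density of compactly supported data in energy + stability of exhaustion).
[folklore] -/
theorem stub_exhaustionDensity :
    (∀ M : ℝ, 0 < M → ∀ (r : ℝ → ℝ) (xc : ℝ), ReggeWheeler.IsTortoiseRadius M r xc →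
      ∀ (s ℓ : ℕ), s ≤ 2 → s ≤ ℓ → ∀ ψ : ℝ → ℝ → ℝ, ReggeWheeler.IsRWSolution M s ℓ r ψ →
        ReggeWheeler.totalEnergy (ReggeWheeler.linePotential M s ℓ r) ψ 0 < ⊤ →
        (∃ a b : ℝ, ReggeWheeler.CauchyDataSupportedOn ψ (Set.Icc a b)) →
        Filter.Tendsto (fun T ↦ ReggeWheeler.channelEnergy (ReggeWheeler.linePotential M s ℓ r) xc 0
          (fun t x ↦ ψ (T + t) x) Filter.atTop) Filter.atTop
          (nhds (ReggeWheeler.totalEnergy (ReggeWheeler.linePotential M s ℓ r) ψ 0))) →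
    ∀ M : ℝ, 0 < M → ∀ (r : ℝ → ℝ) (xc : ℝ), ReggeWheeler.IsTortoiseRadius M r xc →
      ∀ (s ℓ : ℕ), s ≤ 2 → s ≤ ℓ → ∀ ψ : ℝ → ℝ → ℝ, ReggeWheeler.IsRWSolution M s ℓ r ψ →
        ReggeWheeler.totalEnergy (ReggeWheeler.linePotential M s ℓ r) ψ 0 < ⊤ →
        Filter.Tendsto (fun T ↦ ReggeWheeler.channelEnergy (ReggeWheeler.linePotential M s ℓ r) xc 0
          (fun t x ↦ ψ (T + t) x) Filter.atTop) Filter.atTop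
          (nhds (ReggeWheeler.totalEnergy (ReggeWheeler.linePotential M s ℓ r) ψ 0)) := by
  intro H M hM r xc hr s ℓ hs2 hsℓ ψ hψ hE
  have hVd := RW.differentiable_linePotential hr s ℓ
  have hV0 : ∀ x, 0 ≤ linePotential M s ℓ r x := fun x ↦ (RW.linePotential_pos hr hsℓ x).le
  refine RW.exhaustion_of_energy_approx hVd hV0 hψ xc fun ε hε ↦ ?_
  obtain ⟨φ, hφ, hsupp, hφE, hw, hwE⟩ := RW.exists_compactData_approx
    (CauchyWave.contDiff_one_linePotential hr s ℓ) (CauchyWave.abs_linePotential_le hr hsℓ) hV0 hψ hE hε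
  exact ⟨φ, fun t x ↦ ψ t x - φ t x, hφ, hw, fun t x ↦ by ring, hφE, hwE,
    H M hM r xc hr s ℓ hs2 hsℓ φ hφ hφE hsupp⟩

end

end Summit.FinalStateConjecture.FinalStateConjecture.Theorems
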